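import Summits.QuantumFields.YangMills.Theorems.BalabanUVNodesN05SubBP2DK2PerKappaSlotExistsGuarded
import Summits.QuantumFields.YangMills.Theorems.BalabanUVNodesN05JunctionHMemberSuppliers
import Literature.MathematicalPhysics.QuantumFieldTheory.Balaban1983to89.B8TowerBondsLayerLawSubD

/-!
# EDITION «K2» (director-ym №227 (b′-2), plan YMPLAN-G87-N05-GO (R2); dag-n05-d g14, 2026-08-28): this module RE-KEYED onto PRINT's (1.3)–(1.4) CLASS AT THE PINNED BLOCK SIZE on
# the HYPOTHESIS side — the junction binders range over `j : Node00.IdxB8SubDκ θ Mκ Rκ` (print-class members ONLY; N06's `Sep22Zd` currency, dag-n05-w1 `IdxB8SubDκ.sep22Zd`), [4]'s letters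
# and the b9 sockets are supplied ∕ demanded at print-class members only (`Admissible134 θ.L Mκ Rκ i.k i.Ω` as ONE extra member hypothesis), the root is the «K2» κ-periodic root
# `…K2PerKappaSlotExistsGuarded.exists_residB8_b8LeafOfRecordSubBP₂DPerκ_cutSubBP₅κ_of_lettersSrc_γ'_guarded` (Proposition 5 pinned on print's class), `(Mκ Rκ : ℕ)` bound up front,
# the period `Pκ` trailing; proofs VERBATIM (generator `gen_junction_k2.py` on the tree bytes of the κ-periodic editions p647160 ∕ p647574 ∕ p647867).  The rest of this header is
# the κ-periodic edition's VERBATIM.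
# BalabanUVNodes ∕ N05 ([Balaban1985RegularSpaces] Lemma 1 p. 79 – Thm 8 p. 101, (1.3)–(1.5) p. 77, p. 77 «Ω_j ⊂ T_η»): P4 — THE J-N06→N05 JUNCTION ON THE (β′-PERIODIC)
# κ-CUT ROAD, PART 1 of 3 (director-ym №217 (ii) ∕ №220 A-4 ∕ №222 A-5′ (ii): «an N05 discharge is bookable ONLY on the guarded κ-periodic slot road»)

Track A of `YM-PLAN.md` (cell `pub-ymgap`, HUMAN RULING D-0062), node **N05**; seat `pub-ymgap-dag-n05-d` (g14, P4 pen), 2026-08-28; bears on K1⁹ `stmt-QuantumFields-27364`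
(`--supports … --as helper`, count-neutral).

WHAT.  This seat's «P₂D» guarded junction module `BalabanUVNodesN05SubBP2DK2PerKappaSlotExistsOfThm33JunctionHGuarded` (p638889) RE-RUN, token for token by
`gen_junction_per.py` on the tree bytes, with the root `…SlotExistsGuarded.exists_residB8_b8LeafOfRecordSubBP₂DPerκ_cutSubBP₅κ_of_lettersSrc_γ'_guarded` (p638230) REPLACED by its
κ-periodic twin `…PerKappaSlotExistsGuarded.exists_residB8_b8LeafOfRecordSubBP₂DPerκ_cutSubBP₅κ_of_lettersSrc_γ'_guarded` (p646636; same hypotheses + `(P M₁ R : ℕ)`): every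
statement keeps its hypotheses VERBATIM and gains the trailing binders `(Pκ Mκ Rκ : ℕ)` (period, print's block size `M₁`, collar `R`); every conclusion
`∃ lam c₁ ρ₀, 0 < c₁ ∧ 1 ≤ ρ₀ ∧ B8LeafOfRecordSubBP₂Dκ θ Mκ Rκ (lam.cutSubBP₅κPer Pκ Mκ Rκ c₁ ρ₀)` becomes `∃ lam c₁ ρ₀ ax, 0 < c₁ ∧ 1 ≤ ρ₀ ∧ B8LeafOfRecordSubBP₂DPerκ θ Pκ Mκ Rκ ⟨lam.cutSubBP₅κPer Pκ Mκ Rκ c₁ ρ₀, ax⟩`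
(dag-n05-w1's κ-cut periodic δ₂-slot, K2 p643053); every proof is the «P₂D» proof VERBATIM with `Pκ Mκ Rκ` passed through.
* §1 ★★★ `…_junctionH_guarded` — [4]'s letters `SLet ∕ SLetUB`, ANY frame carrying `B9.Thm33Printed`, TEN junction binders at every `j : Node00.IdxB8SubDκ θ Mκ Rκ` ⊢ the κ-periodic row.
* §2 ★★★ `…_junctionH_withQQP_guarded` — the genuine averaging letter (`withQQP`, `havg` discharged), NINE binders ⊢ the κ-periodic row.
HONEST FRAMING: composition BY NAME (the junction's member suppliers + ONE application of the κ-periodic root); 0 estimates; the binders are N06 content at the ℤᵈ-keyed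
(1.3)–(1.5) members (`m ≥ 1` OPEN; class-wide satisfiability NOT claimed); Proposition 7's slot junk-inhabited (census); count-neutral; **N05 NOT discharged** by this file;
K1⁹ NOT claimed; FLAG №10 NOT closed (A-5′ (ii) is dag-n24-w1's instance); Bałaban AS PRINTED (Thm 8 SURVIVING form, GAPS G-B8-13; `T_η` as `P`-periodic data on `ℤᵈ`);
one finite 𝕋⁴ programme at fixed ε; nothing continuum ∕ ℝ⁴ ∕ OS ∕ mass-gap ∕ Clay.  No `sorry`, no new definition.  Unit `pub-ymgap-dag-n05-d` (g14).
[cite: Balaban1985RegularSpaces, Lemma 1 – Thm 8 pp.79–101, Prop. 5 p.94, (1.3)–(1.5) p.77, p.77 («Ω_j ⊂ T_η»), (1.59) p.86; Balaban1985BackgroundPropagators, (3.16) p.393, Thm 3.1 p.397, Thm 3.3 p.399, (3.42)–(3.47) pp.397–398]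
-/

noncomputable section

namespace Summit.QuantumFields.YangMills.BalabanUVNodes.N05SubBP2DK2PerKappaSlotExistsOfThm33JunctionHGuarded

open Literature.MathematicalPhysics.QuantumFieldTheory.Balaban1983to89
open Literature.MathematicalPhysics.QuantumFieldTheory.Balaban1983to89.Node00
open Literature.MathematicalPhysics.QuantumFieldTheory.Balaban1983to89.B8IdxB8LawsB (IdxB8LawsB IdxB8SubB)
open Literature.MathematicalPhysics.QuantumFieldTheory.Balaban1983to89.B8LeafModelZd (ZdIdx)
open Literature.MathematicalPhysics.QuantumFieldTheory.Balaban1983to89.B8LeafModelZd3 (SockB9P3)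
open Literature.MathematicalPhysics.QuantumFieldTheory.Balaban1983to89.B9SupplySockB9P3ZdGammaUnivDelta2 (SockB9P3H2)
open Literature.MathematicalPhysics.QuantumFieldTheory.Balaban1983to89.B8LeafModelZd3P (zdGF3P zdGF3HP)
open Literature.MathematicalPhysics.QuantumFieldTheory.Balaban1983to89.B8LeafModelZd3P2 (zdGF3P₂ zdGF3HP₂)
open Literature.MathematicalPhysics.QuantumFieldTheory.Balaban1983to89.B8TowerBondsPrinted (towerBondsP)
open Literature.MathematicalPhysics.QuantumFieldTheory.Balaban1983to89.B8SockLettersRD (SockLettersRD)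
open Literature.MathematicalPhysics.QuantumFieldTheory.Balaban1983to89.B8Lemma1NonAbelian (mulCfg blockPairNA)
open Literature.MathematicalPhysics.QuantumFieldTheory.Balaban1983to89.B8LanF146 (LanF146)
open Literature.MathematicalPhysics.QuantumFieldTheory.Balaban1983to89.B8Eq138LandauZd (covLap QT InR138 IsLandau146W)
open Literature.MathematicalPhysics.QuantumFieldTheory.Balaban1983to89.B8Prop5LandauDataZd (ZdLanIdx zdLan)
open Summit.QuantumFields.YangMills.BalabanUVNodes.N05SubBP2DK2SlotGammaPrime (b8LeafOfRecordSubBP₂DK2_cutSubBP_zdLan_printCube_of_knit_lettersSrc_γ')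
open MatrixLog B7Prop1Explicit B7Prop2Explicit B7Prop1Local B7Eq92Concrete
open B8Ineq130 (tlo thi)
open B8Ineq132 (InAk covDerivFwd)
open B7Eq78Linearization (zdBlocking QprimeIter)
open B8Eq119TwistedAxial (bgT Restr129 InAx)
open B8Eq140Level (SideTouches)
open B8Eq1117Concrete (XSpace)
open B8Prop5ContractionKLevel (Bd2)
open B8LambdaSpaceKLevel (wt)
open B8Eq184Proof (gaugeExp cfgExp)
open B8Eq146AExpansion (iEta plaqCovDeriv)
open B8Eq143PlaqExpansion (pdiv)
open B7Prop4GeneralLevels (linCovIter)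
open B8Eq155JBound (Jcur wsup)
open B8ScaledSupNorm (bondNorm msup Bdd)
open B9Eq340HolderZd (hquot AdmPair)
open B9SupplySockB9P3ZdLetters (OpsZd)
open B9SupplySockB9P3ZdAt (DictAt Prop6At LandauAt SrcAt)
open B9SupplySockB9P3ZdAtLin (LinBddAt)
open B9SupplySockB9P3ZdGammaUniv (AvgAtP)
open B9SupplySockB9P3ZdGammaInAk (CurvAtInAk)
open B9SupplySockB9P3ZdGammaUnivDelta2 (HolderAtδ2)
open B9SupplySockB9P3ZdAtHerm (InvAtH)
open B9SupplySockB9P3ZdGammaUnivDelta2Src (SrcHolderAtδ2)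
open Summit.QuantumFields.YangMills.BalabanUVNodes.N05JunctionHMemberSuppliers (sockB9P3H2_member_of_junctionH sB9srcHP_member_of_junctionH sH59src_member_of_junctionH)
open B9Eq316AveragingTransposeZd (qQ betaTau alphaQ alphaQ_pos)
open B9Eq316AveragingTransposeZdPrinted (withQQP avgAtP_withQQP)
open B7Prop5GeneralLevels (thetaGen)
open B8TowerBondsLayerLawSubD (IdxB8SubD.levelSepPP_towerBondsP)
open Summit.QuantumFields.YangMills.BalabanUVNodes.N05SubBP2DK2PerKappaSlotExistsGuarded (exists_residB8_b8LeafOfRecordSubBP₂DPerκ_cutSubBP₅κ_of_lettersSrc_γ'_guarded)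
open Literature.MathematicalPhysics.QuantumFieldTheory.Balaban1983to89.B8Eq134Admissible (Admissible134)
-- `Site` alone could resolve to the torus sites of `Setup.lean`; re-export the `ℤ^d` sites of `B7Prop1Explicit`.

export B7Prop1Explicit (Site)

section JunctionHGuarded

/-- Theorem 8's guard `2 ≤ 5dL·B₀` at the junction's constant `B₀′ ≥ 1` (`d ≥ 2`, `L ≥ 5`). [cite: Balaban1985RegularSpaces, Thm 8 p.101 (bookkeeping)] -/
private theorem two_le_guard {D L B : ℝ} (hD : 2 ≤ D) (hL : 5 ≤ L) (hB : 1 ≤ B) : 2 ≤ 5 * D * L * B := by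
  have hDL : 10 ≤ D * L := by nlinarith
  nlinarith [mul_nonneg (sub_nonneg.2 hDL) (sub_nonneg.2 hB)]

/-- ★★★ **(β′-PERIODIC κ-CUT ROAD; director-ym №222 A-5′) GUARDED EDITION** (the witness CARRIES `0 < c₁ ∧ 1 ≤ ρ₀` — director-ym №217 (2)(i), ref-D VERDICT-415) of
★★★ **THE J-N06→N05 JUNCTION APPLIED ON THE «P₂D» ROAD BY NAME** — the N05 row `∃ lam c₁ ρ₀ ax, 0 < c₁ ∧ 1 ≤ ρ₀ ∧ B8LeafOfRecordSubBP₂DPerκ θ Pκ Mκ Rκ ⟨lam.cutSubBP₅κPer Pκ Mκ Rκ c₁ ρ₀, ax⟩` (every period `Pκ`, every pinned pair `(Mκ, Rκ)`; dag-n05-w1's κ-cut periodic δ₂-slot) (the four-pin engine's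
`h05`, Proposition 5's family = print's p. 94 family at dag-n05-w1's P₅-pin) from: [Balaban1985BackgroundPropagators] Thm 3.1's letters `SLet ∕ SLetUB` at the
(1.3)–(1.5)-admissible `Ω₀ = ℤᵈ` law members; N06's **Theorem 3.3 AS PRINTED `B9.Thm33Printed c35 geo bg Gp GA`** at ANY frame; dag-n06-b's junction dictionary binders at
every `j : Node00.IdxB8SubDκ θ Mκ Rκ` (guarded `1 ≤ M → M₃ ≤ M → m ≤ j.1.k`); the junction's primitive constants.  Proof: the three b9 socket families `SB9P ∕ SH59src ∕ SB9srcHP`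
of p619291 SUPPLIED member by member (`BalabanUVNodesN05JunctionHMemberSuppliers`), then ONE application of p619291.  Hypotheses are N06 content; N05 NOT discharged.
[cite: Balaban1985RegularSpaces, Lemma 1 – Thm 8 pp.79–101, Prop. 5 p.94, (1.3)–(1.5) p.77, (1.59) p.86; Balaban1985BackgroundPropagators, Thm 3.1 p.397, Thm 3.3 p.399, (3.42)–(3.47) pp.397–398] -/
theorem exists_residB8_b8LeafOfRecordSubBP₂DPerκ_cutSubBP₅κ_of_letters_thm33_junctionH_guarded (θ : Stage3Params) (hD : 2 ≤ θ.D) (hL5 : 5 ≤ θ.L) (Mκ Rκ : ℕ)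
    -- [Balaban1985BackgroundPropagators] Thm 3.1's letter bounds and threshold
    {B₀'H B₂' BG BR cL : ℝ} (hB₀'H : 0 < B₀'H) (hB₂' : 0 ≤ B₂') (hBG : 0 ≤ BG) (hBR : 0 ≤ BR) (hcL : 0 < cL)
    -- [4]'s letters AT THE (1.3)–(1.5)-ADMISSIBLE `Ω₀ = ℤᵈ` LAW MEMBERS (p619291's texts verbatim): existence side and uniqueness side
    (SLet : ∀ i : ZdIdx θ.D θ.L, i.Ω 0 = Set.univ → IdxB8LawsB θ.L i → B8ConstraintBonds.DomainSeq θ.L i.Ω → (∀ l, l < i.k → ∀ z ∈ i.Λs i.k l, ((θ.L : ℤ) ^ l) • z ∈ B8ConstraintBonds.Lam θ.L i.Ω l) → Admissible134 θ.L Mκ Rκ i.k i.Ω → SockLettersRD (𝔸 := θ.𝔸) θ.L BG BR B₀'H B₂' cL i.η i.k i.Ω i.Λs)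
    (SLetUB : ∀ i : ZdIdx θ.D θ.L, i.Ω 0 = Set.univ → IdxB8LawsB θ.L i → B8ConstraintBonds.DomainSeq θ.L i.Ω → (∀ l, l < i.k → ∀ z ∈ i.Λs i.k l, ((θ.L : ℤ) ^ l) • z ∈ B8ConstraintBonds.Lam θ.L i.Ω l) → Admissible134 θ.L Mκ Rκ i.k i.Ω → ∀ α₀ : ℝ, 0 < α₀ → α₀ ≤ cL → ∀ U₀ : Site θ.D → Fin θ.D → θ.𝔸ˣ, (∀ x κ, U₀ x κ ∈ unitaryUnits θ.𝔸) →
      InAk θ.L i.k i.η α₀ i.Ω U₀ →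
      ∃ (g Δ : (Site θ.D → θ.𝔸) →ₗ[ℂ] (Site θ.D → θ.𝔸)) (q : (Site θ.D → θ.𝔸) →ₗ[ℂ] (ℕ → Site θ.D → θ.𝔸))
        (qs : (ℕ → Site θ.D → θ.𝔸) →ₗ[ℂ] (Site θ.D → θ.𝔸)) (Aw c : (ℕ → Site θ.D → θ.𝔸) →ₗ[ℂ] (ℕ → Site θ.D → θ.𝔸))
        (H' : XSpace θ.D i.k θ.𝔸 →ₗ[ℂ] (Site θ.D → θ.𝔸)),
        (∀ x : Site θ.D → θ.𝔸, (∃ C : ℝ, ∀ y, ‖x y‖ ≤ C) → g (Δ x + qs (Aw (q x))) = x) ∧ (∀ φ, qs (c (q (g (g (qs φ))))) = qs φ) ∧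
        (∀ (f : Site θ.D → θ.𝔸), ∀ x ∈ i.Ω 0, Δ f x = covLap i.η U₀ ((i.Ω 0).indicator f) x) ∧
        (∀ (μ : ℕ → Site θ.D → θ.𝔸), ∀ x ∈ i.Ω 0, qs μ x = QT θ.L i.k (i.Λs i.k) U₀ μ x) ∧
        (∀ (f : Site θ.D → θ.𝔸) (n : ℕ), n ≤ i.k → ∀ y ∈ i.Λs i.k n, q f n y = QprimeIter (zdBlocking θ.D θ.L) (bgT θ.L U₀) n f y) ∧
        (∀ (f : Site θ.D → θ.𝔸) (n : ℕ) (y : Site θ.D), ¬ (n ≤ i.k ∧ y ∈ i.Λs i.k n) → q f n y = 0) ∧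
        (∀ (X : XSpace θ.D i.k θ.𝔸) (x : Site θ.D), ‖H' X x‖ ≤ B₀'H * ‖X‖) ∧
        (∀ n, n ≤ i.k → ∀ (X : XSpace θ.D i.k θ.𝔸), ∀ p ∈ {b : Site θ.D × Fin θ.D | SideTouches (i.Ω n) b.1 b.2},
          wt θ.L i.η n * ‖covDerivFwd i.η U₀ p.2 (H' X) p.1‖ ≤ B₀'H * ‖X‖) ∧
        (∀ X : XSpace θ.D i.k θ.𝔸, Bd2 θ.L i.η i.k i.Ω (covLap i.η U₀ (H' X)) (B₂' * ‖X‖)) ∧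
        (∀ (Y : XSpace θ.D i.k θ.𝔸) (n : ℕ) (hn : n ≤ i.k) (y : Site θ.D), y ∈ i.Λs i.k n →
          QprimeIter (zdBlocking θ.D θ.L) (bgT θ.L U₀) n (H' Y) y = Y (⟨n, Nat.lt_succ_of_le hn⟩, y)) ∧
        (∀ (f : Site θ.D → θ.𝔸) (r : ℝ), 0 ≤ r → Bd2 θ.L i.η i.k i.Ω f r →
          (∀ x, ‖g f x‖ ≤ BG * r) ∧ ∀ n, n ≤ i.k → ∀ p ∈ {b : Site θ.D × Fin θ.D | SideTouches (i.Ω n) b.1 b.2},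
            wt θ.L i.η n * ‖covDerivFwd i.η U₀ p.2 (g f) p.1‖ ≤ BG * r) ∧
        (∀ (f : Site θ.D → θ.𝔸) (r : ℝ), 0 ≤ r → Bd2 θ.L i.η i.k i.Ω f r → Bd2 θ.L i.η i.k i.Ω (f - g (qs (c (q (g f))))) (BR * r)))
    -- N06's FRAME for [4] Thm 3.3 (any index type, geometries, backgrounds, the two kernel families of Thms 3.1–3.3) and its `ℤᵈ` dictionary maps
    {I : Type} (geo : I → B9.Geometry) (bg : I → B9.Backgrounds) (Gp GA : ∀ i, B9.KernelFamily (geo i) (bg i))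
    (mem : ℝ → ZdIdx θ.D θ.L → ℕ → I)
    (ιCfg : ∀ (M : ℝ) (i : ZdIdx θ.D θ.L) (m : ℕ) (U₀ : Site θ.D → Fin θ.D → θ.𝔸ˣ), (∀ x κ, U₀ x κ ∈ unitaryUnits θ.𝔸) → (bg (mem M i m)).Cfg)
    (ιLoc : ∀ (M : ℝ) (i : ZdIdx θ.D θ.L) (m : ℕ), (Site θ.D → Fin θ.D → θ.𝔸) → (geo (mem M i m)).Loc)
    (ops : ℝ → ZdIdx θ.D θ.L → ℕ → OpsZd θ.D θ.𝔸)
    {c35 c₆ K₆ M₃ a₃ c69 q β cS cSβ : ℝ} {CH : ℝ → ℝ} {len : Site θ.D → ℝ}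
    -- N06's THEOREM 3.3 AS PRINTED, by name
    (h33 : B9.Thm33Printed c35 geo bg Gp GA)
    -- dag-n06-b's JUNCTION DICTIONARY BINDERS at the (1.3)–(1.5)-admissible members, guarded (N06 object layer; HYPOTHESES)
    (hdict : ∀ (M : ℝ) (j : IdxB8SubDκ θ Mκ Rκ) (m : ℕ), 1 ≤ M → M₃ ≤ M → m ≤ j.1.1.1.1.1.k → DictAt geo bg GA θ.L mem ιCfg ιLoc ops M j.1.1.1.1.1 m)
    (hP6 : ∀ (M : ℝ) (j : IdxB8SubDκ θ Mκ Rκ) (m : ℕ), 1 ≤ M → M₃ ≤ M → m ≤ j.1.1.1.1.1.k → Prop6At bg θ.L mem ιCfg c35 c₆ K₆ M j.1.1.1.1.1 m)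
    (hinv : ∀ (M : ℝ) (j : IdxB8SubDκ θ Mκ Rκ) (m : ℕ), 1 ≤ M → M₃ ≤ M → m ≤ j.1.1.1.1.1.k → InvAtH bg θ.L mem ιCfg ops c35 a₃ M j.1.1.1.1.1 m)
    (hcurv : ∀ (M : ℝ) (j : IdxB8SubDκ θ Mκ Rκ) (m : ℕ), 1 ≤ M → M₃ ≤ M → m ≤ j.1.1.1.1.1.k → CurvAtInAk θ.L ops c69 M j.1.1.1.1.1 m)
    (hlan : ∀ (M : ℝ) (j : IdxB8SubDκ θ Mκ Rκ) (m : ℕ), 1 ≤ M → M₃ ≤ M → m ≤ j.1.1.1.1.1.k → LandauAt bg θ.L mem ιCfg ops c35 a₃ M j.1.1.1.1.1 m)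
    (havg : ∀ (M : ℝ) (j : IdxB8SubDκ θ Mκ Rκ) (m : ℕ), 1 ≤ M → M₃ ≤ M → m ≤ j.1.1.1.1.1.k →
      AvgAtP θ.L ops q (fun m' l => towerBondsP θ.L j.1.1.1.1.1.Ω (j.1.1.1.1.1.Λs m') l) M j.1.1.1.1.1 m)
    (hhol : ∀ (M : ℝ) (j : IdxB8SubDκ θ Mκ Rκ) (m : ℕ), 1 ≤ M → M₃ ≤ M → m ≤ j.1.1.1.1.1.k → HolderAtδ2 geo bg GA θ.L mem ιCfg ops β len CH M j.1.1.1.1.1 m)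
    (hlin : ∀ (M : ℝ) (j : IdxB8SubDκ θ Mκ Rκ) (m : ℕ), 1 ≤ M → M₃ ≤ M → m ≤ j.1.1.1.1.1.k → LinBddAt θ.L ops M j.1.1.1.1.1 m)
    (hsrc : ∀ (M : ℝ) (j : IdxB8SubDκ θ Mκ Rκ) (m : ℕ), 1 ≤ M → M₃ ≤ M → m ≤ j.1.1.1.1.1.k → SrcAt bg θ.L mem ιCfg ops c35 a₃ cS M j.1.1.1.1.1 m)
    (hsrcH : ∀ (M : ℝ) (j : IdxB8SubDκ θ Mκ Rκ) (m : ℕ), 1 ≤ M → M₃ ≤ M → m ≤ j.1.1.1.1.1.k → SrcHolderAtδ2 bg θ.L mem ιCfg ops c35 a₃ β len cSβ M j.1.1.1.1.1 m)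
    -- the junction's primitive constants ([4] (3.35)∕Prop. 6 `c₆ K₆`, (3.27) `a₃`, (3.69) `c69`, (3.16) `q`, source `c_S c_Sβ`) and Theorem 8's source size factor `γ₈`
    (hc₆ : 0 < c₆) (hK₆ : 0 < K₆) (ha₃ : 0 < a₃) (hc69 : 0 ≤ c69) (hq : 0 ≤ q) (hcS : 0 ≤ cS) (hcSβ : 0 ≤ cSβ) {γ₈ : ℝ} (hγ₈ : 1 ≤ γ₈) (Pκ : ℕ)
    -- Proposition 5's existence (1.108) at the PERIODIC members of record (print's shape) — displayed; served by the guarded periodic Prop 5 (package «N05-(β′)-GT»)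
    (p5ePer : ∀ B₀' B₁ : ℝ, 0 < B₀' → 2 ≤ B₁ → 3 * (2 * (θ.D : ℝ) * (θ.L : ℝ) ^ 2) * BG * BR ≤ B₀' / 2 → B8.Prop5Exists B₀' B₁ (lanOfRecordSubCκPer θ Pκ Mκ Rκ B₁)) :
    ∃ (lam : ResidB8 θ) (c₁ : ℝ) (ρ₀ : ℕ)
      (ax : ∀ j : IdxB8SubDPer θ Pκ, (famB8OfRecordPer θ (lam.cutSubBP₅κPer Pκ Mκ Rκ c₁ ρ₀).β (lam.cutSubBP₅κPer Pκ Mκ Rκ c₁ ρ₀).len Pκ j).Cfg →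
        (famB8OfRecordPer θ (lam.cutSubBP₅κPer Pκ Mκ Rκ c₁ ρ₀).β (lam.cutSubBP₅κPer Pκ Mκ Rκ c₁ ρ₀).len Pκ j).Pert → (famB8OfRecordPer θ (lam.cutSubBP₅κPer Pκ Mκ Rκ c₁ ρ₀).β (lam.cutSubBP₅κPer Pκ Mκ Rκ c₁ ρ₀).len Pκ j).Pert),
      0 < c₁ ∧ 1 ≤ ρ₀ ∧ B8LeafOfRecordSubBP₂DPerκ θ Pκ Mκ Rκ ⟨lam.cutSubBP₅κPer Pκ Mκ Rκ c₁ ρ₀, ax⟩ := by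
  have hL1 : 1 ≤ θ.L := le_trans (by norm_num) hL5
  -- N06's Theorem 3.3: the constants and the `G(U)`-half of its block letter
  obtain ⟨M₁, δ₀, a₀, B₀, Bβ, Bε, Bεβ, -, hδ₀, ha₀, hB₀, H33⟩ := h33
  have H : ∀ i : I, M₁ ≤ (geo i).M → ∀ α₀ : ℝ, 0 < α₀ → (geo i).M * α₀ ≤ a₀ → ∀ U : (bg i).Cfg, (bg i).Reg335 c35 α₀ U →
      B9.Ineq342_346_347 (GA i) B₀ δ₀ U ∧ B9.Ineq343_345 (GA i) Bβ Bε Bεβ δ₀ U :=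
    fun i hM α hα hMa U hreg => (H33 i hM α hα hMa U hreg).2
  -- the big-block size at which the junction is read
  obtain ⟨M, hM_def⟩ : ∃ M : ℝ, M = max 1 (max M₁ M₃) := ⟨_, rfl⟩
  have hM1 : 1 ≤ M := by rw [hM_def]; exact le_max_left _ _
  have hMM₁ : M₁ ≤ M := by rw [hM_def]; exact (le_max_left _ _).trans (le_max_right _ _)
  have hMM₃ : M₃ ≤ M := by rw [hM_def]; exact (le_max_right _ _).trans (le_max_right _ _)
  have hM0 : 0 < M := lt_of_lt_of_le one_pos hM1
  have hKM : 0 < K₆ * M := mul_pos hK₆ hM0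
  -- the junction's output constants, named
  obtain ⟨cP, hcP_def⟩ : ∃ cP : ℝ,
      cP = min (1 / 16) (min (c₆ / M) (min (a₀ / (K₆ * M)) (min (a₃ / (K₆ * M)) (1 / (2 * B₀ * c69 * M + 1))))) := ⟨_, rfl⟩
  have hcP : 0 < cP := by
    rw [hcP_def]
    refine lt_min (by norm_num) (lt_min (div_pos hc₆ hM0) (lt_min (div_pos ha₀ hKM) (lt_min (div_pos ha₃ hKM) ?_)))
    have : 0 < 2 * B₀ * c69 * M + 1 := by positivity
    positivity
  obtain ⟨B', hB'_def⟩ : ∃ B' : ℝ, B' = max 1 (2 * B₀ * max 1 q) := ⟨_, rfl⟩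
  have hB'1 : 1 ≤ B' := by rw [hB'_def]; exact le_max_left _ _
  obtain ⟨B₀βc, hB₀βc_def⟩ : ∃ B₀βc : ℝ, B₀βc = 2 * max 0 (CH δ₀ * (B₀ + max 0 (Bβ β))) * max 1 q + 1 := ⟨_, rfl⟩
  have hB₀β0 : 0 ≤ 2 * max 0 (CH δ₀ * (B₀ + max 0 (Bβ β))) * max 1 q := by positivity
  have hB₀βc : 2 * max 0 (CH δ₀ * (B₀ + max 0 (Bβ β))) * max 1 q ≤ B₀βc := by rw [hB₀βc_def]; linarith
  have hB₀βc0 : 0 < B₀βc := by rw [hB₀βc_def]; linarith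
  obtain ⟨γc, hγc_def⟩ : ∃ γc : ℝ, γc = 2 * cS * γ₈ / B' := ⟨_, rfl⟩
  have hγc0 : 0 ≤ γc := by
    have hγ₈0 : 0 ≤ γ₈ := by linarith
    have hB'0 : 0 < B' := by linarith
    rw [hγc_def]; positivity
  obtain ⟨γβc, hγβc_def⟩ : ∃ γβc : ℝ, γβc = (max 0 (CH δ₀ * (B₀ + max 0 (Bβ β))) * cS / B₀ + cSβ) * γ₈ := ⟨_, rfl⟩
  have hD' : (2 : ℝ) ≤ θ.D := by exact_mod_cast hD
  have hL5' : (5 : ℝ) ≤ θ.L := by exact_mod_cast hL5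
  have hB : 2 ≤ 5 * (θ.D : ℝ) * θ.L * B' := two_le_guard hD' hL5' hB'1
  -- the GUARDED row supplier (`…SlotExistsGuarded`), its three b9 families supplied member by member from the junction
  refine exists_residB8_b8LeafOfRecordSubBP₂DPerκ_cutSubBP₅κ_of_lettersSrc_γ'_guarded θ hD hL5 Mκ Rκ (B₀ := B') (B₀β := B₀βc) (β := β) (len := len) (cB9 := cP)
    hcP hB₀'H hB₂' hBG hBR hcL SLet SLetUB ?_ (cP3 := cP) (γ₈ := γ₈) (γ' := γc) (γ'' := γc) (γβ := γβc) hcP hγ₈ hγc0 hγc0 hB hB₀βc0 ?_ ?_ Pκ p5ePer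
  · -- `SB9P`: Prop. 3's frame, sourceless, at the top truncation
    intro i hΩ hl hd hlt hκ
    obtain ⟨j, hj⟩ : ∃ j : IdxB8SubDκ θ Mκ Rκ, j.1.1.1.1.1 = i := ⟨⟨⟨(⟨⟨⟨i, hΩ⟩, hl⟩, hd⟩ : IdxB8SubC θ), hlt⟩, hκ⟩, rfl⟩
    subst hj
    exact sockB9P3H2_member_of_junctionH geo bg GA θ.L mem ιCfg ιLoc ops hD hL1 hB₀ hδ₀ H hM1 hMM₁ j.1.1.1.1.1 hΩ
      (hdict M j _ hM1 hMM₃ le_rfl) (hP6 M j _ hM1 hMM₃ le_rfl) (hinv M j _ hM1 hMM₃ le_rfl) (hcurv M j _ hM1 hMM₃ le_rfl)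
      (hlan M j _ hM1 hMM₃ le_rfl) (havg M j _ hM1 hMM₃ le_rfl) (hhol M j _ hM1 hMM₃ le_rfl) hK₆ hc69 hq hB'_def hcP_def hB₀βc
  · -- `SH59src`: Thm 4's frame with source, every radius `r ≥ 0`
    intro r hr
    have hK₀ : 0 < 2 * (θ.L * (5 * (θ.D : ℝ) * θ.L * 1)) + 8 * (8 * r * (5 * (θ.D : ℝ) * θ.L * 1)) := by
      have h1 : 0 < 2 * (θ.L * (5 * (θ.D : ℝ) * θ.L * 1)) := by positivity
      have h2 : 0 ≤ 8 * (8 * r * (5 * (θ.D : ℝ) * θ.L * 1)) := by positivity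
      linarith
    refine ⟨min cP (cP / (2 * (θ.L * (5 * (θ.D : ℝ) * θ.L * 1)) + 8 * (8 * r * (5 * (θ.D : ℝ) * θ.L * 1)))), lt_min hcP (div_pos hcP hK₀),
      fun i hΩ hl hd hlt hκ => ?_⟩
    obtain ⟨j, hj⟩ : ∃ j : IdxB8SubDκ θ Mκ Rκ, j.1.1.1.1.1 = i := ⟨⟨⟨(⟨⟨⟨i, hΩ⟩, hl⟩, hd⟩ : IdxB8SubC θ), hlt⟩, hκ⟩, rfl⟩
    subst hj
    exact sH59src_member_of_junctionH geo bg GA θ.L mem ιCfg ιLoc ops hD hL1 hB₀ hδ₀ H hM1 hMM₁ j.1.1.1.1.1 hΩ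
      (fun m hm => hdict M j m hM1 hMM₃ hm) (fun m hm => hP6 M j m hM1 hMM₃ hm) (fun m hm => hinv M j m hM1 hMM₃ hm)
      (fun m hm => hcurv M j m hM1 hMM₃ hm) (fun m hm => havg M j m hM1 hMM₃ hm) (fun m hm => hhol M j m hM1 hMM₃ hm)
      (fun m hm => hlin M j m hM1 hMM₃ hm) (fun m hm => hsrc M j m hM1 hMM₃ hm) (fun m hm => hsrcH M j m hM1 hMM₃ hm)
      hK₆ hc69 hq hcS hcSβ γ₈ hB'_def hcP_def hγc_def r hr
  · -- `SB9srcHP`: Prop. 3's frame with source, five (1.59) lines, at the top truncation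
    intro i hΩ hl hd hlt hκ
    obtain ⟨j, hj⟩ : ∃ j : IdxB8SubDκ θ Mκ Rκ, j.1.1.1.1.1 = i := ⟨⟨⟨(⟨⟨⟨i, hΩ⟩, hl⟩, hd⟩ : IdxB8SubC θ), hlt⟩, hκ⟩, rfl⟩
    subst hj
    exact sB9srcHP_member_of_junctionH geo bg GA θ.L mem ιCfg ιLoc ops hD hL1 hB₀ hδ₀ H hM1 hMM₁ j.1.1.1.1.1 hΩ
      (hdict M j _ hM1 hMM₃ le_rfl) (hP6 M j _ hM1 hMM₃ le_rfl) (hinv M j _ hM1 hMM₃ le_rfl) (hcurv M j _ hM1 hMM₃ le_rfl)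
      (havg M j _ hM1 hMM₃ le_rfl) (hhol M j _ hM1 hMM₃ le_rfl) (hlin M j _ hM1 hMM₃ le_rfl) (hsrc M j _ hM1 hMM₃ le_rfl)
      (hsrcH M j _ hM1 hMM₃ le_rfl) hK₆ hc69 hq hcS hcSβ γ₈ hB'_def hcP_def hγc_def hγβc_def hB₀βc

end JunctionHGuarded

section WithQQPGuarded

/-- `q = qQ d L C_τ β_τ 1 ≥ 0` when `C_τ` bounds `|Re τ(x*y)|` (dag-n05-e's `qQ_one_nonneg`, re-proved to keep the import light). [cite: Balaban1985BackgroundPropagators, (3.16) p.393 (bookkeeping)] -/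
private theorem qQ_one_nonneg' {d L : ℕ} {𝔸 : Type*} [CStarAlgebra 𝔸] [Nontrivial 𝔸] [FiniteDimensional ℝ 𝔸] (τ : 𝔸 →ₗ[ℂ] ℂ) (hL : 1 ≤ L) {Cτ : ℝ}
    (hCτ : ∀ x y : 𝔸, |(τ (star x * y)).re| ≤ Cτ * ‖x‖ * ‖y‖) : 0 ≤ qQ d L Cτ (betaTau τ) 1 := by
  have hCτ0 : 0 ≤ Cτ := by
    have h := hCτ 1 1
    simp only [star_one, norm_one, mul_one] at h
    exact (abs_nonneg _).trans h
  have hβ : 0 ≤ betaTau τ := by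
    unfold betaTau
    split_ifs
    · exact Finset.sum_nonneg fun i _ => mul_nonneg (norm_nonneg _) (norm_nonneg _)
    · exact le_rfl
  have hθ : 0 ≤ 1 + thetaGen d L (alphaQ d L) := by
    have := alphaQ_pos d hL
    unfold thetaGen
    positivity
  unfold qQ
  positivity

/-- ★★★ **(β′-PERIODIC κ-CUT ROAD; director-ym №222 A-5′) GUARDED EDITION** (the witness CARRIES `0 < c₁ ∧ 1 ≤ ρ₀` — director-ym №217 (2)(i), ref-D VERDICT-415) of
★★★ **THE J-N06→N05 JUNCTION APPLIED ON THE «P₂D» ROAD, GENUINE AVERAGING LETTER** — the N05 row `∃ lam c₁ ρ₀ ax, 0 < c₁ ∧ 1 ≤ ρ₀ ∧ B8LeafOfRecordSubBP₂DPerκ θ Pκ Mκ Rκ ⟨lam.cutSubBP₅κPer Pκ Mκ Rκ c₁ ρ₀, ax⟩` (every period `Pκ`, every pinned pair `(Mκ, Rκ)`; dag-n05-w1's κ-cut periodic δ₂-slot) from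
[4]'s letters `SLet ∕ SLetUB`, N06's `B9.Thm33Printed c35 geo bg Gp GA`, and NINE junction dictionary binders at every `j : Node00.IdxB8SubDκ θ Mκ Rκ` (no `havg`), the letter
family pinned pointwise to dag-n06-b's `withQQP τ θ.L (towerBondsP-class of the member) ops₀` and `q := qQ θ.D θ.L C_τ β_τ 1`.  Proof: the companion theorem with
`havg` supplied by `avgAtP_withQQP` at dag-n05-w2's outright class law `IdxB8SubD.levelSepPP_towerBondsP`.  Hypotheses are N06 content; N05 NOT discharged.
[cite: Balaban1985RegularSpaces, Lemma 1 – Thm 8 pp.79–101, (1.31) p.82, (1.3)–(1.5) p.77; Balaban1985BackgroundPropagators, (3.16) p.393, Thm 3.1 p.397, Thm 3.3 p.399] -/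
theorem exists_residB8_b8LeafOfRecordSubBP₂DPerκ_cutSubBP₅κ_of_letters_thm33_junctionH_withQQP_guarded (θ : Stage3Params) (hD : 2 ≤ θ.D) (hL5 : 5 ≤ θ.L) (Mκ Rκ : ℕ)
    -- [Balaban1985BackgroundPropagators] Thm 3.1's letter bounds and threshold
    {B₀'H B₂' BG BR cL : ℝ} (hB₀'H : 0 < B₀'H) (hB₂' : 0 ≤ B₂') (hBG : 0 ≤ BG) (hBR : 0 ≤ BR) (hcL : 0 < cL)
    -- [4]'s letters AT THE (1.3)–(1.5)-ADMISSIBLE `Ω₀ = ℤᵈ` LAW MEMBERS (p619291's texts verbatim): existence side and uniqueness side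
    (SLet : ∀ i : ZdIdx θ.D θ.L, i.Ω 0 = Set.univ → IdxB8LawsB θ.L i → B8ConstraintBonds.DomainSeq θ.L i.Ω → (∀ l, l < i.k → ∀ z ∈ i.Λs i.k l, ((θ.L : ℤ) ^ l) • z ∈ B8ConstraintBonds.Lam θ.L i.Ω l) → Admissible134 θ.L Mκ Rκ i.k i.Ω → SockLettersRD (𝔸 := θ.𝔸) θ.L BG BR B₀'H B₂' cL i.η i.k i.Ω i.Λs)
    (SLetUB : ∀ i : ZdIdx θ.D θ.L, i.Ω 0 = Set.univ → IdxB8LawsB θ.L i → B8ConstraintBonds.DomainSeq θ.L i.Ω → (∀ l, l < i.k → ∀ z ∈ i.Λs i.k l, ((θ.L : ℤ) ^ l) • z ∈ B8ConstraintBonds.Lam θ.L i.Ω l) → Admissible134 θ.L Mκ Rκ i.k i.Ω → ∀ α₀ : ℝ, 0 < α₀ → α₀ ≤ cL → ∀ U₀ : Site θ.D → Fin θ.D → θ.𝔸ˣ, (∀ x κ, U₀ x κ ∈ unitaryUnits θ.𝔸) →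
      InAk θ.L i.k i.η α₀ i.Ω U₀ →
      ∃ (g Δ : (Site θ.D → θ.𝔸) →ₗ[ℂ] (Site θ.D → θ.𝔸)) (q : (Site θ.D → θ.𝔸) →ₗ[ℂ] (ℕ → Site θ.D → θ.𝔸))
        (qs : (ℕ → Site θ.D → θ.𝔸) →ₗ[ℂ] (Site θ.D → θ.𝔸)) (Aw c : (ℕ → Site θ.D → θ.𝔸) →ₗ[ℂ] (ℕ → Site θ.D → θ.𝔸))
        (H' : XSpace θ.D i.k θ.𝔸 →ₗ[ℂ] (Site θ.D → θ.𝔸)),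
        (∀ x : Site θ.D → θ.𝔸, (∃ C : ℝ, ∀ y, ‖x y‖ ≤ C) → g (Δ x + qs (Aw (q x))) = x) ∧ (∀ φ, qs (c (q (g (g (qs φ))))) = qs φ) ∧
        (∀ (f : Site θ.D → θ.𝔸), ∀ x ∈ i.Ω 0, Δ f x = covLap i.η U₀ ((i.Ω 0).indicator f) x) ∧
        (∀ (μ : ℕ → Site θ.D → θ.𝔸), ∀ x ∈ i.Ω 0, qs μ x = QT θ.L i.k (i.Λs i.k) U₀ μ x) ∧
        (∀ (f : Site θ.D → θ.𝔸) (n : ℕ), n ≤ i.k → ∀ y ∈ i.Λs i.k n, q f n y = QprimeIter (zdBlocking θ.D θ.L) (bgT θ.L U₀) n f y) ∧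
        (∀ (f : Site θ.D → θ.𝔸) (n : ℕ) (y : Site θ.D), ¬ (n ≤ i.k ∧ y ∈ i.Λs i.k n) → q f n y = 0) ∧
        (∀ (X : XSpace θ.D i.k θ.𝔸) (x : Site θ.D), ‖H' X x‖ ≤ B₀'H * ‖X‖) ∧
        (∀ n, n ≤ i.k → ∀ (X : XSpace θ.D i.k θ.𝔸), ∀ p ∈ {b : Site θ.D × Fin θ.D | SideTouches (i.Ω n) b.1 b.2},
          wt θ.L i.η n * ‖covDerivFwd i.η U₀ p.2 (H' X) p.1‖ ≤ B₀'H * ‖X‖) ∧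
        (∀ X : XSpace θ.D i.k θ.𝔸, Bd2 θ.L i.η i.k i.Ω (covLap i.η U₀ (H' X)) (B₂' * ‖X‖)) ∧
        (∀ (Y : XSpace θ.D i.k θ.𝔸) (n : ℕ) (hn : n ≤ i.k) (y : Site θ.D), y ∈ i.Λs i.k n →
          QprimeIter (zdBlocking θ.D θ.L) (bgT θ.L U₀) n (H' Y) y = Y (⟨n, Nat.lt_succ_of_le hn⟩, y)) ∧
        (∀ (f : Site θ.D → θ.𝔸) (r : ℝ), 0 ≤ r → Bd2 θ.L i.η i.k i.Ω f r →
          (∀ x, ‖g f x‖ ≤ BG * r) ∧ ∀ n, n ≤ i.k → ∀ p ∈ {b : Site θ.D × Fin θ.D | SideTouches (i.Ω n) b.1 b.2},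
            wt θ.L i.η n * ‖covDerivFwd i.η U₀ p.2 (g f) p.1‖ ≤ BG * r) ∧
        (∀ (f : Site θ.D → θ.𝔸) (r : ℝ), 0 ≤ r → Bd2 θ.L i.η i.k i.Ω f r → Bd2 θ.L i.η i.k i.Ω (f - g (qs (c (q (g f))))) (BR * r)))
    -- N06's FRAME for [4] Thm 3.3 (any index type, geometries, backgrounds, the two kernel families of Thms 3.1–3.3) and its `ℤᵈ` dictionary maps
    {I : Type} (geo : I → B9.Geometry) (bg : I → B9.Backgrounds) (Gp GA : ∀ i, B9.KernelFamily (geo i) (bg i))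
    (mem : ℝ → ZdIdx θ.D θ.L → ℕ → I)
    (ιCfg : ∀ (M : ℝ) (i : ZdIdx θ.D θ.L) (m : ℕ) (U₀ : Site θ.D → Fin θ.D → θ.𝔸ˣ), (∀ x κ, U₀ x κ ∈ unitaryUnits θ.𝔸) → (bg (mem M i m)).Cfg)
    (ιLoc : ∀ (M : ℝ) (i : ZdIdx θ.D θ.L) (m : ℕ), (Site θ.D → Fin θ.D → θ.𝔸) → (geo (mem M i m)).Loc)
    (ops : ℝ → ZdIdx θ.D θ.L → ℕ → OpsZd θ.D θ.𝔸)
    -- THE GENUINE AVERAGING LETTER: `ops` carries dag-n06-b's `withQQP` co-letter `(Q*Q)(U₀)` at print's class of the member ([4] (3.16); trace functional `τ`)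
    [FiniteDimensional ℝ θ.𝔸] (τ : θ.𝔸 →ₗ[ℂ] ℂ) {Cτ : ℝ} (hCτ : ∀ x y : θ.𝔸, |(τ (star x * y)).re| ≤ Cτ * ‖x‖ * ‖y‖)
    (ops₀ : ℝ → ZdIdx θ.D θ.L → ℕ → OpsZd θ.D θ.𝔸)
    (hops : ∀ (M : ℝ) (i : ZdIdx θ.D θ.L) (m : ℕ), ops M i m = withQQP τ θ.L (fun m' l => towerBondsP θ.L i.Ω (i.Λs m') l) ops₀ M i m)
    {c35 c₆ K₆ M₃ a₃ c69 β cS cSβ : ℝ} {CH : ℝ → ℝ} {len : Site θ.D → ℝ}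
    -- N06's THEOREM 3.3 AS PRINTED, by name
    (h33 : B9.Thm33Printed c35 geo bg Gp GA)
    -- dag-n06-b's JUNCTION DICTIONARY BINDERS at the (1.3)–(1.5)-admissible members, guarded (N06 object layer; HYPOTHESES) — NO `havg`
    (hdict : ∀ (M : ℝ) (j : IdxB8SubDκ θ Mκ Rκ) (m : ℕ), 1 ≤ M → M₃ ≤ M → m ≤ j.1.1.1.1.1.k → DictAt geo bg GA θ.L mem ιCfg ιLoc ops M j.1.1.1.1.1 m)
    (hP6 : ∀ (M : ℝ) (j : IdxB8SubDκ θ Mκ Rκ) (m : ℕ), 1 ≤ M → M₃ ≤ M → m ≤ j.1.1.1.1.1.k → Prop6At bg θ.L mem ιCfg c35 c₆ K₆ M j.1.1.1.1.1 m)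
    (hinv : ∀ (M : ℝ) (j : IdxB8SubDκ θ Mκ Rκ) (m : ℕ), 1 ≤ M → M₃ ≤ M → m ≤ j.1.1.1.1.1.k → InvAtH bg θ.L mem ιCfg ops c35 a₃ M j.1.1.1.1.1 m)
    (hcurv : ∀ (M : ℝ) (j : IdxB8SubDκ θ Mκ Rκ) (m : ℕ), 1 ≤ M → M₃ ≤ M → m ≤ j.1.1.1.1.1.k → CurvAtInAk θ.L ops c69 M j.1.1.1.1.1 m)
    (hlan : ∀ (M : ℝ) (j : IdxB8SubDκ θ Mκ Rκ) (m : ℕ), 1 ≤ M → M₃ ≤ M → m ≤ j.1.1.1.1.1.k → LandauAt bg θ.L mem ιCfg ops c35 a₃ M j.1.1.1.1.1 m)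
    (hhol : ∀ (M : ℝ) (j : IdxB8SubDκ θ Mκ Rκ) (m : ℕ), 1 ≤ M → M₃ ≤ M → m ≤ j.1.1.1.1.1.k → HolderAtδ2 geo bg GA θ.L mem ιCfg ops β len CH M j.1.1.1.1.1 m)
    (hlin : ∀ (M : ℝ) (j : IdxB8SubDκ θ Mκ Rκ) (m : ℕ), 1 ≤ M → M₃ ≤ M → m ≤ j.1.1.1.1.1.k → LinBddAt θ.L ops M j.1.1.1.1.1 m)
    (hsrc : ∀ (M : ℝ) (j : IdxB8SubDκ θ Mκ Rκ) (m : ℕ), 1 ≤ M → M₃ ≤ M → m ≤ j.1.1.1.1.1.k → SrcAt bg θ.L mem ιCfg ops c35 a₃ cS M j.1.1.1.1.1 m)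
    (hsrcH : ∀ (M : ℝ) (j : IdxB8SubDκ θ Mκ Rκ) (m : ℕ), 1 ≤ M → M₃ ≤ M → m ≤ j.1.1.1.1.1.k → SrcHolderAtδ2 bg θ.L mem ιCfg ops c35 a₃ β len cSβ M j.1.1.1.1.1 m)
    -- the junction's primitive constants ([4] (3.35)∕Prop. 6 `c₆ K₆`, (3.27) `a₃`, (3.69) `c69`, source `c_S c_Sβ`) and Theorem 8's source size factor `γ₈`
    (hc₆ : 0 < c₆) (hK₆ : 0 < K₆) (ha₃ : 0 < a₃) (hc69 : 0 ≤ c69) (hcS : 0 ≤ cS) (hcSβ : 0 ≤ cSβ) {γ₈ : ℝ} (hγ₈ : 1 ≤ γ₈) (Pκ : ℕ)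
    -- Proposition 5's existence (1.108) at the PERIODIC members of record (print's shape) — displayed; served by the guarded periodic Prop 5 (package «N05-(β′)-GT»)
    (p5ePer : ∀ B₀' B₁ : ℝ, 0 < B₀' → 2 ≤ B₁ → 3 * (2 * (θ.D : ℝ) * (θ.L : ℝ) ^ 2) * BG * BR ≤ B₀' / 2 → B8.Prop5Exists B₀' B₁ (lanOfRecordSubCκPer θ Pκ Mκ Rκ B₁)) :
    ∃ (lam : ResidB8 θ) (c₁ : ℝ) (ρ₀ : ℕ)
      (ax : ∀ j : IdxB8SubDPer θ Pκ, (famB8OfRecordPer θ (lam.cutSubBP₅κPer Pκ Mκ Rκ c₁ ρ₀).β (lam.cutSubBP₅κPer Pκ Mκ Rκ c₁ ρ₀).len Pκ j).Cfg →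
        (famB8OfRecordPer θ (lam.cutSubBP₅κPer Pκ Mκ Rκ c₁ ρ₀).β (lam.cutSubBP₅κPer Pκ Mκ Rκ c₁ ρ₀).len Pκ j).Pert → (famB8OfRecordPer θ (lam.cutSubBP₅κPer Pκ Mκ Rκ c₁ ρ₀).β (lam.cutSubBP₅κPer Pκ Mκ Rκ c₁ ρ₀).len Pκ j).Pert),
      0 < c₁ ∧ 1 ≤ ρ₀ ∧ B8LeafOfRecordSubBP₂DPerκ θ Pκ Mκ Rκ ⟨lam.cutSubBP₅κPer Pκ Mκ Rκ c₁ ρ₀, ax⟩ := by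
  have hL1 : 1 ≤ θ.L := le_trans (by norm_num) hL5
  refine exists_residB8_b8LeafOfRecordSubBP₂DPerκ_cutSubBP₅κ_of_letters_thm33_junctionH_guarded θ hD hL5 Mκ Rκ hB₀'H hB₂' hBG hBR hcL SLet SLetUB geo bg Gp GA mem ιCfg ιLoc ops
    (q := qQ θ.D θ.L Cτ (betaTau τ) 1) h33 hdict hP6 hinv hcurv hlan ?_ hhol hlin hsrc hsrcH hc₆ hK₆ ha₃ hc69 (qQ_one_nonneg' τ hL1 hCτ) hcS hcSβ hγ₈ Pκ p5ePer
  -- `havg` DISCHARGED: the genuine letter's (3.16) bound at print's class, whose box law holds outright on `IdxB8SubDκ θ Mκ Rκ`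
  intro M j m _ _ hm U₀ hU₀ A hOn j₀ hj₀ y μ ht
  rw [hops]
  exact avgAtP_withQQP τ θ.L hD θ.two_le_L hCτ _ ops₀ M j.1.1.1.1.1 m (IdxB8SubD.levelSepPP_towerBondsP j.1 m hm) U₀ hU₀ A hOn j₀ hj₀ y μ ht

end WithQQPGuarded

end Summit.QuantumFields.YangMills.BalabanUVNodes.N05SubBP2DK2PerKappaSlotExistsOfThm33JunctionHGuarded

end
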